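import Literature.NumberTheory.Sieve.MontgomeryVaughan1975Section8
import Literature.NumberTheory.Sieve.GoldbachLinnikMVMajorArcBridge
import HarnessLib

/-!
# Montgomery–Vaughan 1975, §8 made POINTWISE: a lower bound for the major-arc integral at every
even `n ∈ [X/2, X]` with the exceptional prime built in, PROVED

Topic `Literature/NumberTheory/Sieve`, namespace `Literature.NumberTheory.Sieve.MontgomeryVaughan1975`
(continuation of `MontgomeryVaughan1975Section8.lean` and `GoldbachLinnikMVMajorArcBridge.lean`).

Montgomery–Vaughan [MontgomeryVaughanActa1975, §8 (8.3)–(8.6)] deduce from their major-arc formulae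
(6.17), (6.1͂7) (tree: `majorArc_formulae`, here taken AT ONE LEVEL `P = X^{6a}` as a hypothesis in
the shape of `majorArc_formulae_forall_small`) that `R₁(n) > XP^{−1/3}` for all even `X/2 < n ≤ X`
outside a small exceptional set.  For Linnik's problem (Gallagher 1975) one needs instead a bound
for EVERY even `n`, relative to `𝔖(n)`: this file proves, at a level where every exceptional
conductor satisfies `24 (4C/κC₂)² < r̃ ≤ P^{2/3}` (level selection by Page, `levelSelection`; and
`r̃ → ∞`, `exceptionalConductor_unbounded`), that for every even `n` with `X/2 ≤ n ≤ X`
`R^G_{𝔐̃}(X; n) ≥ −κ𝔖(n)X`, and `R^G_{𝔐̃}(X; n) ≥ (2/3)𝔖(n)n − κ𝔖(n)X` whenever some prime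
`p > 3` of the exceptional conductor does not divide `n` (then `|𝔖̃(n)/𝔖(n)| ≤ (p−2)⁻¹ ≤ 1/3` by
(8.5) `abs_excRatio_le`, and `Ĩ(n) ≤ n^{β̃} ≤ n` by (6.21) `excPairSum_le_rpow`); here
`R^G_{𝔐̃}(X; n) = Re ∫_{[0,1]∩𝔐̃} A_X² e(−nα)` is the log-weighted Goldbach major-arc integral of
Heath-Brown–Puchta's frame on the periodised arcs `𝔐̃ = periodicArcs P Q`
(`abs_majorArcGoldbachIntegral_periodicArcs_sub_re_le'`: it differs from `Re R₁(n)` by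
`≤ 48P²X/Q`).  The error terms of (6.17)/(6.1͂7) are absorbed into `κ𝔖(n)X` using
`𝔖(n) ≥ C₂ n/φ(n)` (`twinPrimeConst_mul_div_totient_le`), `r̃/φ(r̃)² ≤ (24/r̃)^{1/2}` for odd `r̃`
(`cast_div_totient_sq_le`, `prod_inv_sub_two_le_rpow`), `(n, r̃) ≤ r̃ ≤ P^{2/3}` and the numerical
thresholds, which are hypotheses here (discharged «eventually in `X`» by the consumer).  This is
the static core of the piece `stub_pointwise_of` of the parity-ideate route `LinnikGallagherMV`
(crux «PointwiseMajorArcsMV»).  No new facts.  Written for the parity-ideate cell (literature seat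
g16, 2026-08-27).

* `prod_inv_sub_two_le_one`, `prod_inv_sub_two_le_third_of_mem` — the product in (8.5) is `≤ 1`,
  and `≤ 1/3` if it contains a prime not dividing `n`.
* `pointwise_lowerBound_of_formulae` — the statement above.

## References

* [MontgomeryVaughanActa1975] H. L. Montgomery, R. C. Vaughan, *The exceptional set in Goldbach's
  problem*, Acta Arith. 27 (1975) 353–370: §6 (6.17), (6.1͂7), (6.21), §8 (8.3)–(8.6).
* [Gallagher1975] P. X. Gallagher, *Primes and powers of 2*, Invent. Math. 29 (1975) 125–142,
  §§3–4 (the pointwise use of the major arcs with an exceptional character).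

## Mathlib / tree search

Tree: `abs_excRatio_le`, `excPairSum_le_rpow`, `excPairSum_nonneg`, `cast_div_totient_sq_le`,
`prod_inv_sub_two_le_rpow`, `re_ge_of_norm_sub_le` (`MontgomeryVaughan1975Section8`);
`twinPrimeConst_mul_div_totient_le`, `one_le_goldbachSingularSeries` (`MontgomeryVaughan1975Tools`);
`GoldbachLinnik.abs_majorArcGoldbachIntegral_periodicArcs_sub_re_le'` (`GoldbachLinnikMVMajorArcBridge`).
`lean search 'pointwise_lowerBound_of_formulae|prod_inv_sub_two_le_one'`: nothing before this file.
-/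

noncomputable section

open Finset MeasureTheory Filter

namespace Literature.NumberTheory.Sieve.MontgomeryVaughan1975

/-! ### The product `∏_{p ∣ r̃, p ∤ n, p > 3} (p − 2)⁻¹` of (8.5) -/

/-- Each factor `(p − 2)⁻¹`, `p > 3`, lies in `[0, 1]`, so the product in (8.5) is at most `1`
(`|𝔖̃(n)| ≤ 𝔖(n)` always). [cite: MontgomeryVaughanActa1975, §8 (8.5)] -/
theorem prod_inv_sub_two_le_one (r n : ℕ) :
    ∏ p ∈ r.primeFactors.filter (fun p => ¬ p ∣ n ∧ 3 < p), ((p : ℝ) - 2)⁻¹ ≤ 1 := by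
  refine Finset.prod_le_one (fun p hp => ?_) fun p hp => ?_
  · have : (4 : ℝ) ≤ p := by exact_mod_cast (Finset.mem_filter.mp hp).2.2
    exact inv_nonneg.mpr (by linarith)
  · have : (4 : ℝ) ≤ p := by exact_mod_cast (Finset.mem_filter.mp hp).2.2
    exact inv_le_one_of_one_le₀ (by linarith)

/-- If a prime `q > 3` of `r̃` does not divide `n`, the product in (8.5) is `≤ (q − 2)⁻¹ ≤ 1/3`
(Montgomery–Vaughan 1975, p. 368: "`|𝔖̃(n)| ≤ 𝔖(n)/3`"). [cite: MontgomeryVaughanActa1975, §8 (8.5)] -/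
theorem prod_inv_sub_two_le_third_of_mem {r n q : ℕ} (hq : q ∈ r.primeFactors) (hq3 : 3 < q)
    (hqn : ¬ q ∣ n) :
    ∏ p ∈ r.primeFactors.filter (fun p => ¬ p ∣ n ∧ 3 < p), ((p : ℝ) - 2)⁻¹ ≤ 1 / 3 := by
  set T := r.primeFactors.filter (fun p => ¬ p ∣ n ∧ 3 < p) with hT
  have hqT : q ∈ T := Finset.mem_filter.mpr ⟨hq, hqn, hq3⟩
  have hnonneg : ∀ p ∈ T, 0 ≤ ((p : ℝ) - 2)⁻¹ := by
    intro p hp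
    have : (4 : ℝ) ≤ p := by exact_mod_cast (Finset.mem_filter.mp hp).2.2
    exact inv_nonneg.mpr (by linarith)
  have hle1 : ∀ p ∈ T, ((p : ℝ) - 2)⁻¹ ≤ 1 := by
    intro p hp
    have : (4 : ℝ) ≤ p := by exact_mod_cast (Finset.mem_filter.mp hp).2.2
    exact inv_le_one_of_one_le₀ (by linarith)
  rw [← Finset.mul_prod_erase T _ hqT]
  have hq5 : (5 : ℝ) ≤ q := by
    have hqp : q.Prime := Nat.prime_of_mem_primeFactors hq
    have h4 : q ≠ 4 := by rintro rfl; exact absurd hqp (by decide)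
    exact_mod_cast (show 5 ≤ q by omega)
  have h1 : ((q : ℝ) - 2)⁻¹ ≤ 1 / 3 := by
    rw [one_div]; exact inv_anti₀ (by norm_num) (by linarith)
  have h2 : ∏ p ∈ T.erase q, ((p : ℝ) - 2)⁻¹ ≤ 1 :=
    Finset.prod_le_one (fun p hp => hnonneg p (Finset.mem_of_mem_erase hp))
      fun p hp => hle1 p (Finset.mem_of_mem_erase hp)
  have h3 : 0 ≤ ∏ p ∈ T.erase q, ((p : ℝ) - 2)⁻¹ :=
    Finset.prod_nonneg fun p hp => hnonneg p (Finset.mem_of_mem_erase hp)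
  calc ((q : ℝ) - 2)⁻¹ * ∏ p ∈ T.erase q, ((p : ℝ) - 2)⁻¹ ≤ (1 / 3) * 1 :=
        mul_le_mul h1 h2 h3 (by norm_num)
    _ = 1 / 3 := by ring

/-! ### The pointwise lower bound at one level -/

/-- **Montgomery–Vaughan's §8 made pointwise** (the major-arc input of Gallagher's proof of
Linnik's theorem).  Let `P = X^{6a}`, `Q = X^{1−6a}` (`X = N` an integer), and suppose: the
major-arc formulae (6.17)/(7.1) and (6.1͂7)/(7.͂1) hold at this level with constants `c₁, c₆, C`
(hypothesis `hF`, the shape of `majorArc_formulae_forall_small` at `δ := a`); every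
`c₁`-exceptional conductor at level `P` satisfies `r̃ ≤ P^{2/3}` (`hsel`, cf. `levelSelection`),
`24 < r̃` and `24(4C/(κC₂))² < r̃` (`hbig`, cf. `exceptionalConductor_unbounded`); and the
thresholds `2 ≤ P`, `P + 1 < Q`, `c₁ < log P`, `C X^{1+a}P⁻¹ ≤ κX/4`, `C X^{1+a}P⁻¹P^{2/3} ≤ κX/4`,
`48P²X/Q ≤ κX/4`, `C e^{−c₆/a} ≤ κC₂/4`, `C c₁ e^{−c₆/a} ≤ κC₂/4` hold.  Then for every even `n`
with `X/2 ≤ n ≤ X`: `R^G_{periodicArcs P Q}(X; n) ≥ −κ𝔖(n)X`, and if for every exceptional datum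
`(r̃, χ̃, β̃)` some prime `p > 3`, `p ∣ r̃`, does not divide `n`, then
`R^G_{periodicArcs P Q}(X; n) ≥ (2/3)𝔖(n)n − κ𝔖(n)X`
(no exceptional character: (6.17) gives `𝔖(n)n − O(κ𝔖(n)X)`; exceptional: main term
`𝔖(n)(n + (𝔖̃/𝔖)Ĩ(n)) ≥ 𝔖(n)(1 − ∏_{p∣r̃,p∤n,p>3}(p−2)⁻¹)n ≥ 0`, resp. `≥ (2/3)𝔖(n)n`, by (8.5)
and `Ĩ(n) ≤ n^{β̃} ≤ n` (6.21); errors: `(n,r̃)=1 ⇒ r̃` odd and `r̃n X/(φ(r̃)²φ(n)) ≤ (24/r̃)^{1/2}(n/φ(n))X`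
(8.4), `X^{1+a}P⁻¹(n,r̃) ≤ X^{1+a}P^{−1/3}`, `(1−β̃)log P ≤ c₁`, and `C₂ n/φ(n) ≤ 𝔖(n)`, `𝔖(n) ≥ 1`).
[cite: MontgomeryVaughanActa1975, §8 (8.3)–(8.6); Gallagher1975, §4] -/
theorem pointwise_lowerBound_of_formulae {c₁ c₆ C a κ : ℝ} {N : ℕ}
    (hc₁ : 0 < c₁) (hC : 0 < C) (hκ : 0 < κ)
    (hP2 : 2 ≤ (N : ℝ) ^ (6 * a)) (hPQ : (N : ℝ) ^ (6 * a) + 1 < (N : ℝ) ^ (1 - 6 * a))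
    (hlogP : c₁ < Real.log ((N : ℝ) ^ (6 * a)))
    (hF : Lemma41At c₁ ((N : ℝ) ^ (6 * a)) ∧
      (((∀ (r : ℕ) [NeZero r] (χ : DirichletCharacter ℂ r) (β : ℝ),
            ¬ IsExceptionalZero c₁ ((N : ℝ) ^ (6 * a)) r χ β) →
        ∀ n : ℕ, 1 ≤ n → (n : ℝ) ≤ (N : ℝ) →
          ‖majorArcIntegral ((N : ℝ) ^ (6 * a)) ((N : ℝ) ^ (1 - 6 * a)) (N : ℝ) n -
              ((goldbachSingularSeries n * n : ℝ) : ℂ)‖ ≤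
            C * ((N : ℝ) ^ (1 + a) * ((N : ℝ) ^ (6 * a))⁻¹ +
              (n : ℝ) / (Nat.totient n : ℝ) * (N : ℝ) * Real.exp (-(c₆ / a))))) ∧
      (∀ (r : ℕ) [NeZero r] (χ : DirichletCharacter ℂ r) (β : ℝ),
          IsExceptionalZero c₁ ((N : ℝ) ^ (6 * a)) r χ β →
        ∀ n : ℕ, 1 ≤ n → (n : ℝ) ≤ (N : ℝ) → Even n →
          ‖majorArcIntegral ((N : ℝ) ^ (6 * a)) ((N : ℝ) ^ (1 - 6 * a)) (N : ℝ) n -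
              ((goldbachSingularSeries n *
                  (n + excRatio χ n * excPairSum ((N : ℝ) ^ (6 * a)) (N : ℝ) β n) : ℝ) : ℂ)‖ ≤
            C * ((if n.Coprime r then (r : ℝ) * n * (N : ℝ) / ((Nat.totient r : ℝ) ^ 2 * Nat.totient n)
                  else 0) +
              (N : ℝ) ^ (1 + a) * ((N : ℝ) ^ (6 * a))⁻¹ * Nat.gcd n r +
              (n : ℝ) / (Nat.totient n : ℝ) * (N : ℝ) * ((1 - β) * Real.log ((N : ℝ) ^ (6 * a))) *
                Real.exp (-(c₆ / a)))))
    (hsel : ∀ (r : ℕ) [NeZero r] (χ : DirichletCharacter ℂ r) (β : ℝ),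
      IsExceptionalZero c₁ ((N : ℝ) ^ (6 * a)) r χ β → (r : ℝ) ≤ ((N : ℝ) ^ (6 * a)) ^ (2 / 3 : ℝ))
    (hbig : ∀ (r : ℕ) [NeZero r] (χ : DirichletCharacter ℂ r) (β : ℝ),
      IsExceptionalZero c₁ ((N : ℝ) ^ (6 * a)) r χ β →
        (24 : ℝ) < r ∧ 24 * (4 * C / (κ * twinPrimeConst)) ^ 2 < (r : ℝ))
    (hT3 : C * ((N : ℝ) ^ (1 + a) * ((N : ℝ) ^ (6 * a))⁻¹) ≤ κ / 4 * N)
    (hT4 : C * ((N : ℝ) ^ (1 + a) * ((N : ℝ) ^ (6 * a))⁻¹ * ((N : ℝ) ^ (6 * a)) ^ (2 / 3 : ℝ)) ≤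
      κ / 4 * N)
    (hT5 : 48 * ((N : ℝ) ^ (6 * a)) ^ 2 * N / (N : ℝ) ^ (1 - 6 * a) ≤ κ / 4 * N)
    (hexp : C * Real.exp (-(c₆ / a)) ≤ κ / 4 * twinPrimeConst)
    (hexp' : C * (c₁ * Real.exp (-(c₆ / a))) ≤ κ / 4 * twinPrimeConst) :
    ∀ n : ℕ, Even n → N ≤ 2 * n → n ≤ N →
      -(κ * (goldbachSingularSeries n * N)) ≤
          GoldbachLinnik.majorArcGoldbachIntegral
            (GoldbachLinnik.periodicArcs ((N : ℝ) ^ (6 * a)) ((N : ℝ) ^ (1 - 6 * a))) N n ∧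
      ((∀ (r : ℕ) [NeZero r] (χ : DirichletCharacter ℂ r) (β : ℝ),
          IsExceptionalZero c₁ ((N : ℝ) ^ (6 * a)) r χ β → ∃ q ∈ r.primeFactors, 3 < q ∧ ¬ q ∣ n) →
        2 / 3 * (goldbachSingularSeries n * n) - κ * (goldbachSingularSeries n * N) ≤
          GoldbachLinnik.majorArcGoldbachIntegral
            (GoldbachLinnik.periodicArcs ((N : ℝ) ^ (6 * a)) ((N : ℝ) ^ (1 - 6 * a))) N n) := by
  intro n heven hNn hnN
  obtain ⟨h41, hI, hII⟩ := hF
  -- `N ≥ 1` (otherwise `P = 0^{6a} ∈ {0, 1}` contradicts `2 ≤ P`)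
  have hN1 : 1 ≤ N := by
    by_contra h
    have hN0 : N = 0 := by omega
    rw [hN0, Nat.cast_zero] at hP2
    rcases eq_or_ne (6 * a) 0 with h6 | h6
    · rw [h6, Real.rpow_zero] at hP2; exact absurd hP2 (by norm_num)
    · rw [Real.zero_rpow h6] at hP2; exact absurd hP2 (by norm_num)
  -- the bridge `|R^G − Re R₁| ≤ 48 P² X/Q` (before introducing notation)
  have hP1 : (1 : ℝ) ≤ (N : ℝ) ^ (6 * a) := le_trans (by norm_num) hP2
  have hbr := GoldbachLinnik.abs_majorArcGoldbachIntegral_periodicArcs_sub_re_le' N n hP1 hPQ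
  -- notation and positivity
  set P : ℝ := (N : ℝ) ^ (6 * a) with hPdef
  set Q : ℝ := (N : ℝ) ^ (1 - 6 * a) with hQdef
  set X : ℝ := (N : ℝ) with hXdef
  have hC₂ : 0 < twinPrimeConst := lt_of_lt_of_le (by norm_num) half_le_twinPrimeConst
  have hP0 : 0 < P := lt_of_lt_of_le (by norm_num) hP2
  have hlogP0 : 0 < Real.log P := lt_trans hc₁ hlogP
  have hX1 : (1 : ℝ) ≤ X := by rw [hXdef]; exact_mod_cast hN1
  have hX0 : 0 < X := lt_of_lt_of_le zero_lt_one hX1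
  have hn1 : 1 ≤ n := by omega
  have hn0 : n ≠ 0 := by omega
  have hn1' : (1 : ℝ) ≤ n := by exact_mod_cast hn1
  have hnpos : (0 : ℝ) < n := lt_of_lt_of_le zero_lt_one hn1'
  have hnX : (n : ℝ) ≤ X := by rw [hXdef]; exact_mod_cast hnN
  have hXn : X ≤ 2 * n := by rw [hXdef]; exact_mod_cast hNn
  -- `t = n/φ(n) ≥ 1`, `C₂ t ≤ 𝔖(n)`, `1 ≤ 𝔖(n)`
  have hφn : (0 : ℝ) < Nat.totient n := by exact_mod_cast Nat.totient_pos.mpr (by omega)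
  have ht1 : 1 ≤ (n : ℝ) / (Nat.totient n : ℝ) := by
    rw [le_div_iff₀ hφn, one_mul]; exact_mod_cast Nat.totient_le n
  have h𝔖t : twinPrimeConst * ((n : ℝ) / (Nat.totient n : ℝ)) ≤ goldbachSingularSeries n :=
    twinPrimeConst_mul_div_totient_le heven hn0
  have h𝔖1 : 1 ≤ goldbachSingularSeries n := one_le_goldbachSingularSeries heven
  have hε0 : 0 ≤ Real.exp (-(c₆ / a)) := (Real.exp_pos _).le
  -- the two integrals become opaque reals
  generalize hRGdef : GoldbachLinnik.majorArcGoldbachIntegral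
    (GoldbachLinnik.periodicArcs P Q) N n = RG at hbr ⊢
  clear hRGdef
  by_cases hexc : ∃ (r : ℕ) (_ : NeZero r) (χ : DirichletCharacter ℂ r) (β : ℝ),
      IsExceptionalZero c₁ P r χ β
  · -- ### exceptional character `(r, χ, β)`
    obtain ⟨r, hr0, χ, β, hEZ⟩ := hexc
    have hquad : χ ^ 2 = 1 := h41.1 r χ β hEZ
    have hEZ' := hEZ
    obtain ⟨hprim, -, hrP, hβlo, hβ1, -⟩ := hEZ'
    have hr : r ≠ 0 := NeZero.ne r
    have hrpos : (0 : ℝ) < r := by exact_mod_cast Nat.pos_of_ne_zero hr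
    have hφr : (0 : ℝ) < Nat.totient r := by
      exact_mod_cast Nat.totient_pos.mpr (Nat.pos_of_ne_zero hr)
    have hβ0 : 0 < β := by
      have : c₁ / Real.log P < 1 := (div_lt_one hlogP0).mpr hlogP
      linarith
    have hsel' : (r : ℝ) ≤ P ^ (2 / 3 : ℝ) := hsel r χ β hEZ
    have hbig' : 24 * (4 * C / (κ * twinPrimeConst)) ^ 2 < (r : ℝ) := (hbig r χ β hEZ).2
    -- the formula (6.1͂7); the major-arc integral becomes an opaque real
    have hB := hII r χ β hEZ n hn1 hnX heven
    have hRe := re_ge_of_norm_sub_le hB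
    clear hB hI hII
    generalize hR1def : (majorArcIntegral P Q X n).re = R₁ at hRe hbr
    clear hR1def
    -- the arithmetic inputs, then abbreviations
    have hρπ := abs_excRatio_le hprim hquad heven hn0
    have hπ1 := prod_inv_sub_two_le_one r n
    have hI0 := excPairSum_nonneg P X β n
    have hIn : excPairSum P X β n ≤ n := by
      calc excPairSum P X β n ≤ (n : ℝ) ^ β := excPairSum_le_rpow hP2 hβ0 hβ1.le n
        _ ≤ (n : ℝ) ^ (1 : ℝ) := Real.rpow_le_rpow_of_exponent_le hn1' hβ1.le
        _ = n := Real.rpow_one _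
    -- with a prime `q > 3` of `r` not dividing `n`: `π ≤ 1/3`
    have hgood' : (∀ (r : ℕ) [NeZero r] (χ : DirichletCharacter ℂ r) (β : ℝ),
        IsExceptionalZero c₁ P r χ β → ∃ q ∈ r.primeFactors, 3 < q ∧ ¬ q ∣ n) →
        ∏ p ∈ r.primeFactors.filter (fun p => ¬ p ∣ n ∧ 3 < p), ((p : ℝ) - 2)⁻¹ ≤ 1 / 3 := by
      intro hgood
      obtain ⟨q, hq, hq3, hqn⟩ := hgood r χ β hEZ
      exact prod_inv_sub_two_le_third_of_mem hq hq3 hqn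
    -- `(n,r) = 1 ⇒ r odd ⇒ r/φ(r)² ≤ (24/r)^{1/2}`
    have hq : n.Coprime r → (r : ℝ) / (Nat.totient r : ℝ) ^ 2 ≤ (24 / (r : ℝ)) ^ (1 / 2 : ℝ) := by
      intro hcop
      have hodd : Odd r := by
        by_contra h2
        have h2r : 2 ∣ r := even_iff_two_dvd.mp (Nat.not_odd_iff_even.mp h2)
        have h2n : 2 ∣ n := even_iff_two_dvd.mp heven
        have h21 : 2 ∣ Nat.gcd n r := Nat.dvd_gcd h2n h2r
        rw [Nat.Coprime.gcd_eq_one hcop] at h21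
        have := Nat.le_of_dvd one_pos h21
        omega
      exact (cast_div_totient_sq_le hprim hquad hodd).trans (prod_inv_sub_two_le_rpow hprim hquad)
    have hgcd : (Nat.gcd n r : ℝ) ≤ r := by
      exact_mod_cast Nat.gcd_le_right (m := n) (n := r) (Nat.pos_of_ne_zero hr)
    set 𝔖 : ℝ := goldbachSingularSeries n with h𝔖def
    set t : ℝ := (n : ℝ) / (Nat.totient n : ℝ) with htdef
    set ε : ℝ := Real.exp (-(c₆ / a)) with hεdef
    set L : ℝ := (1 - β) * Real.log P with hLdef
    set ρ : ℝ := excRatio χ n with hρdef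
    set I : ℝ := excPairSum P X β n with hIdef
    set E₁ : ℝ := (if n.Coprime r then (r : ℝ) * n * X / ((Nat.totient r : ℝ) ^ 2 * Nat.totient n)
      else 0) with hE₁def
    set G : ℝ := (Nat.gcd n r : ℝ) with hGdef
    set π : ℝ := ∏ p ∈ r.primeFactors.filter (fun p => ¬ p ∣ n ∧ 3 < p), ((p : ℝ) - 2)⁻¹
      with hπdef
    set φr : ℝ := (Nat.totient r : ℝ) with hφrdef
    set P23 : ℝ := P ^ (2 / 3 : ℝ) with hP23def
    set XP : ℝ := X ^ (1 + a) * P⁻¹ with hXPdef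
    set S24 : ℝ := (24 / (r : ℝ)) ^ (1 / 2 : ℝ) with hS24def
    set nn : ℝ := (n : ℝ) with hnndef
    set rr : ℝ := (r : ℝ) with hrrdef
    have hS24 : S24 = Real.sqrt (24 / rr) := by rw [hS24def, Real.sqrt_eq_rpow]
    clear_value 𝔖 t ε L ρ I E₁ G π φr P23 XP S24 nn rr P Q X
    -- ## pure real arithmetic from here on
    have h𝔖0 : 0 ≤ 𝔖 := by linarith
    have ht0 : 0 ≤ t := by linarith
    have hκ𝔖X : 0 ≤ κ * (𝔖 * X) := by positivity
    -- `L ∈ [0, c₁]`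
    have hL0 : 0 ≤ L := by rw [hLdef]; exact mul_nonneg (by linarith) hlogP0.le
    have hLc : L ≤ c₁ := by
      have h1 : 1 - β ≤ c₁ / Real.log P := by linarith
      calc L = (1 - β) * Real.log P := hLdef
        _ ≤ c₁ / Real.log P * Real.log P := mul_le_mul_of_nonneg_right h1 hlogP0.le
        _ = c₁ := div_mul_cancel₀ c₁ hlogP0.ne'
    -- main term: `𝔖 (n + ρ I) ≥ 𝔖 (1 - π) n ≥ 0`
    have hmainπ : 𝔖 * ((1 - π) * nn) ≤ 𝔖 * (nn + ρ * I) := by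
      apply mul_le_mul_of_nonneg_left _ h𝔖0
      have h1 : |ρ * I| ≤ π * nn := by
        rw [abs_mul, abs_of_nonneg hI0]
        exact mul_le_mul hρπ hIn hI0 ((abs_nonneg ρ).trans hρπ)
      have := (abs_le.mp h1).1
      linarith
    have hmain0 : 0 ≤ 𝔖 * ((1 - π) * nn) :=
      mul_nonneg h𝔖0 (mul_nonneg (by linarith) hnpos.le)
    -- `C₂ t X ≤ 𝔖 X`
    have h𝔖tX : twinPrimeConst * t * X ≤ 𝔖 * X := mul_le_mul_of_nonneg_right h𝔖t hX0.le
    -- error 1: the coprime term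
    have hE₁ : C * E₁ ≤ κ / 4 * (𝔖 * X) := by
      by_cases hcop : n.Coprime r
      · have hq' : rr / φr ^ 2 ≤ S24 := hq hcop
        set M : ℝ := 4 * C / (κ * twinPrimeConst) with hMdef
        have hM : 0 < M := by positivity
        have h24r : 24 / rr ≤ (1 / M) ^ 2 := by
          rw [div_le_iff₀ hrpos]
          have h1 : (1 / M) ^ 2 * (24 * M ^ 2) ≤ (1 / M) ^ 2 * rr :=
            mul_le_mul_of_nonneg_left hbig'.le (sq_nonneg _)
          have h2 : (1 / M) ^ 2 * (24 * M ^ 2) = 24 := by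
            rw [show (1 / M) ^ 2 * (24 * M ^ 2) = 24 * (M * (1 / M)) ^ 2 by ring,
              mul_one_div_cancel hM.ne', one_pow, mul_one]
          linarith
        have hsq : S24 ≤ 1 / M := by
          rw [hS24]
          calc Real.sqrt (24 / rr) ≤ Real.sqrt ((1 / M) ^ 2) := Real.sqrt_le_sqrt h24r
            _ = 1 / M := Real.sqrt_sq (by positivity)
        have hCM : C * (1 / M) = κ / 4 * twinPrimeConst := by
          rw [hMdef, one_div_div, mul_div_assoc',
            show C * (κ * twinPrimeConst) = κ / 4 * twinPrimeConst * (4 * C) by ring,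
            mul_div_cancel_right₀ _ (by positivity : (4 : ℝ) * C ≠ 0)]
        have hE₁eq : E₁ = rr / φr ^ 2 * (t * X) := by
          rw [hE₁def, if_pos hcop, htdef]
          field_simp
        rw [hE₁eq]
        calc C * (rr / φr ^ 2 * (t * X)) = (C * (rr / φr ^ 2)) * (t * X) := by ring
          _ ≤ (C * (1 / M)) * (t * X) := by
              apply mul_le_mul_of_nonneg_right _ (by positivity)
              exact mul_le_mul_of_nonneg_left (hq'.trans hsq) hC.le
          _ = κ / 4 * (twinPrimeConst * t * X) := by rw [hCM]; ring
          _ ≤ κ / 4 * (𝔖 * X) := mul_le_mul_of_nonneg_left h𝔖tX (by positivity)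
      · rw [hE₁def, if_neg hcop, mul_zero]; positivity
    -- error 2: the gcd term `C X^{1+a} P⁻¹ (n,r) ≤ C X^{1+a}P⁻¹ P^{2/3} ≤ κ X/4 ≤ (κ/4) 𝔖 X`
    have hXP0 : 0 ≤ XP := by rw [hXPdef]; positivity
    have hE₂ : C * (XP * G) ≤ κ / 4 * (𝔖 * X) := by
      have hGP : G ≤ P23 := hgcd.trans hsel'
      calc C * (XP * G) ≤ C * (XP * P23) := by
            apply mul_le_mul_of_nonneg_left _ hC.le
            exact mul_le_mul_of_nonneg_left hGP hXP0
        _ = C * (XP * P23) := rfl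
        _ ≤ κ / 4 * X := hT4
        _ ≤ κ / 4 * (𝔖 * X) :=
            mul_le_mul_of_nonneg_left (le_mul_of_one_le_left hX0.le h𝔖1) (by positivity)
    -- error 3: `C t X L ε ≤ C c₁ ε t X ≤ (κ/4) C₂ t X ≤ (κ/4) 𝔖 X`
    have hE₃ : C * (t * X * L * ε) ≤ κ / 4 * (𝔖 * X) := by
      have htXε : 0 ≤ t * X * ε := by positivity
      calc C * (t * X * L * ε) ≤ C * (t * X * c₁ * ε) := by
            apply mul_le_mul_of_nonneg_left _ hC.le
            rw [show t * X * L * ε = L * (t * X * ε) by ring,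
              show t * X * c₁ * ε = c₁ * (t * X * ε) by ring]
            exact mul_le_mul_of_nonneg_right hLc htXε
        _ = (C * (c₁ * ε)) * (t * X) := by ring
        _ ≤ (κ / 4 * twinPrimeConst) * (t * X) := mul_le_mul_of_nonneg_right hexp' (by positivity)
        _ = κ / 4 * (twinPrimeConst * t * X) := by ring
        _ ≤ κ / 4 * (𝔖 * X) := mul_le_mul_of_nonneg_left h𝔖tX (by positivity)
    -- the bridge error `≤ κ X/4 ≤ (κ/4) 𝔖 X`
    have hE₄ : |RG - R₁| ≤ κ / 4 * (𝔖 * X) :=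
      hbr.trans (hT5.trans
        (mul_le_mul_of_nonneg_left (le_mul_of_one_le_left hX0.le h𝔖1) (by positivity)))
    have hE₄' := (abs_le.mp hE₄).1
    have herr : C * (E₁ + XP * G + t * X * L * ε) ≤ 3 * (κ / 4 * (𝔖 * X)) := by
      have : C * (E₁ + XP * G + t * X * L * ε) = C * E₁ + C * (XP * G) + C * (t * X * L * ε) := by
        ring
      rw [this]; linarith
    refine ⟨by linarith, fun hgood => ?_⟩
    have hπ3 : π ≤ 1 / 3 := hgood' hgood
    have hmain : 𝔖 * (2 / 3 * nn) ≤ 𝔖 * ((1 - π) * nn) := by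
      apply mul_le_mul_of_nonneg_left _ h𝔖0
      exact mul_le_mul_of_nonneg_right (by linarith) hnpos.le
    linarith
  · -- ### no exceptional character: (6.17)
    have hno : ∀ (r : ℕ) [NeZero r] (χ : DirichletCharacter ℂ r) (β : ℝ),
        ¬ IsExceptionalZero c₁ P r χ β := by
      intro r _ χ β h
      exact hexc ⟨r, ‹NeZero r›, χ, β, h⟩
    have hB := hI hno n hn1 hnX
    have hRe := re_ge_of_norm_sub_le hB
    clear hB hI hII
    generalize hR1def : (majorArcIntegral P Q X n).re = R₁ at hRe hbr
    clear hR1def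
    set 𝔖 : ℝ := goldbachSingularSeries n with h𝔖def
    set t : ℝ := (n : ℝ) / (Nat.totient n : ℝ) with htdef
    set ε : ℝ := Real.exp (-(c₆ / a)) with hεdef
    set XP : ℝ := X ^ (1 + a) * P⁻¹ with hXPdef
    set nn : ℝ := (n : ℝ) with hnndef
    clear_value 𝔖 t ε XP nn P Q X
    -- ## pure real arithmetic from here on
    have h𝔖0 : 0 ≤ 𝔖 := by linarith
    have ht0 : 0 ≤ t := by linarith
    have hκ𝔖X : 0 ≤ κ * (𝔖 * X) := by positivity
    have h𝔖tX : twinPrimeConst * t * X ≤ 𝔖 * X := mul_le_mul_of_nonneg_right h𝔖t hX0.le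
    have hE₀ : C * XP ≤ κ / 4 * (𝔖 * X) :=
      hT3.trans (mul_le_mul_of_nonneg_left (le_mul_of_one_le_left hX0.le h𝔖1) (by positivity))
    have hE₃ : C * (t * X * ε) ≤ κ / 4 * (𝔖 * X) := by
      calc C * (t * X * ε) = (C * ε) * (t * X) := by ring
        _ ≤ (κ / 4 * twinPrimeConst) * (t * X) := mul_le_mul_of_nonneg_right hexp (by positivity)
        _ = κ / 4 * (twinPrimeConst * t * X) := by ring
        _ ≤ κ / 4 * (𝔖 * X) := mul_le_mul_of_nonneg_left h𝔖tX (by positivity)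
    have hE₄ : |RG - R₁| ≤ κ / 4 * (𝔖 * X) :=
      hbr.trans (hT5.trans
        (mul_le_mul_of_nonneg_left (le_mul_of_one_le_left hX0.le h𝔖1) (by positivity)))
    have hE₄' := (abs_le.mp hE₄).1
    have herr : C * (XP + t * X * ε) ≤ 2 * (κ / 4 * (𝔖 * X)) := by
      rw [mul_add]; linarith
    have hmain : 𝔖 * (2 / 3 * nn) ≤ 𝔖 * nn := by
      apply mul_le_mul_of_nonneg_left _ h𝔖0; linarith
    have hmain0 : 0 ≤ 𝔖 * nn := by positivity
    refine ⟨by linarith, fun _ => by linarith⟩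

end Literature.NumberTheory.Sieve.MontgomeryVaughan1975

end
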